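import Mathlib
import HarnessLib
import Summits.HubbardSuperconductivity.HubbardSuperconductivity.Theorems.KLProgrammeC4aPPKernelTrueNumeratorD2

/-!
# Route `KLProgramme` — crux C4a, S3 brick (B4) «(B4)-UMK1», «(M1)-TRUE-KERNEL» for the (U1)-LAWS INTERFACE, SIGNED partner levels: the DERIVATIVE envelope
# `|∂ᵤ[N(e,u)/(e+u)]| ≤ C·(max e |u|)⁻²` — split-free near the anti-diagonal `u ≈ −e`, and under the support condition `c·e ≤ |u|` away from it

Cell `gate-hubbard-kl`, seat hubbard-kl-k3c3-p1 (g15; row «δμ-flow with klAngularMean constant piece»).  Conclusion of `…TrueSigned` / `…TrueNumeratorD2` (memo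
`M1-TRUE-KERNEL.md` §8).  On the punctured line `e + u ≠ 0` the signed pp kernel is `K(u) = N(e,u)/(e+u)` with derivative
`K′(u) = ∂ᵤN(e,u)/(e+u) − N(e,u)/(e+u)² = ψ(u)/(e+u)²`, `ψ(u) = ∂ᵤN·(e+u) − N`, `ψ(−e) = 0`, `ψ′(v) = ∂ᵤ²N(e,v)·(e+v)`.
* §1 `hasDerivAt_trueKernel_signed` (the quotient rule on `e+u ≠ 0`), `abs_ppTrueNumeratorDuu_le_of_scale` (`M ≤ 2|v| ⟹ |∂ᵤ²N(e,v)| ≤ (64B₂+96B₁+132)/M²`),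
  `segment_scale_of_near_antidiag` (`0 < e`, `|e+u| ≤ M/2`, `M = max e |u|` ⟹ every `v` between `−e` and `u` has `M ≤ 2|v|`);
* §2 **`abs_trueKernelDu_signed_near_le`** (`0 < e`, `e+u ≠ 0`, `|e+u| ≤ M/2`): `|K′(u)| ≤ (64B₂+96B₁+132)·M⁻²` — NO split, via the mean-value theorem for `ψ`;
* §3 **`abs_trueKernelDu_signed_far_le`** (`0 < e`, `M/2 ≤ |e+u|`, support condition `c·e ≤ |u|`, `0 < c ≤ 1`): `|K′(u)| ≤ ((12B₁+9)/c + 4)·M⁻²`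
  (`|∂ᵤN| ≤ (6B₁+9/2)/(c·M)` from `|u| ≥ cM`: far levels `2/|u|`, near levels the uniform gradient; `|N| ≤ 1`);
* §4 **`abs_trueKernelDu_signed_le_inv_max_sq`**: both regimes ⟹ for `0 < e`, `e + u ≠ 0`, `c·e ≤ |u|`:
  `|K′(u)| ≤ (64B₂+96B₁+132 + (12B₁+9)/c + 4)·(max e |u|)⁻¹²` = the (U1)-LAWS `hK1` shape on the split's support, T- and Λ-free.
Honest reading: (i) the single point `u = −e` is excluded (there `N/(e+u)` as a Lean term is `0`, not the smooth value `∂ᵤN(e,−e)`); a consumer's smooth kernel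
(product form `(2/β)ΣWW(eu+ωₙ²)/((ωₙ²+e²)(ωₙ²+u²))`) agrees with `N/(e+u)` off that point and inherits the bound there by continuity of ITS derivative;
(ii) away from the anti-diagonal the support condition is load-bearing (memo §7 caveat (a)); (iii) `B₂ = sup|χ″|` enters only through near-shell levels `max e |u| ≤ 2Λ`.
Pure real analysis; nothing asserts (C), K3 or superconductivity.
References: BGM 2006 §2.4 (2.36) [cite: BenfattoGiulianiMastropietro2006]; Salmhofer 1999 §4.2.5 [cite: Salmhofer1999].
-/

noncomputable section

namespace Summit.HubbardSuperconductivity.HubbardSuperconductivity.Theorems.C4a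

set_option linter.dupNamespace false -- summit = problem name (single-conjunct summit), D-0017

open Real Filter Set
open scoped Topology
open Literature.MathematicalPhysics.QuantumLattice Literature.Analysis.SpecialFunctions

/-! ## §1 Tools -/

/-- The quotient rule for the signed kernel on `e + u ≠ 0`: `d/du[N(e,u)/(e+u)] = ∂ᵤN/(e+u) − N/(e+u)²`. [cite: BenfattoGiulianiMastropietro2006, §2.4 (2.36)] -/
theorem hasDerivAt_trueKernel_signed {β Λ : ℝ} (hβ : 0 < β) (hΛ : 0 < Λ) {B₁ : ℝ} (hB₁ : ∀ x, |deriv salmhoferCutoff x| ≤ B₁) {e u : ℝ} (hs : e + u ≠ 0) :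
    HasDerivAt (fun v : ℝ => ppTrueNumerator β Λ e v / (e + v))
      (ppTrueNumeratorDu β Λ e u / (e + u) - ppTrueNumerator β Λ e u / (e + u) ^ 2) u := by
  have hN := hasDerivAt_ppTrueNumerator_u hβ hΛ hB₁ e u
  have hD : HasDerivAt (fun v : ℝ => e + v) 1 u := (hasDerivAt_id u).const_add e
  have h := hN.div hD hs
  refine h.congr_deriv ?_
  field_simp

/-- **`∂ᵤ²N` against a scale `M ≤ 2|v|`**: `|∂ᵤ²N(e,v)| ≤ (64B₂+96B₁+132)/M²` (far levels `3/v² ≤ 12/M²`; near levels `|v| ≤ Λ ⟹ M ≤ 2Λ` and the uniform bound).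
[cite: BenfattoGiulianiMastropietro2006, §2.4 (2.36)] -/
theorem abs_ppTrueNumeratorDuu_le_of_scale {β Λ : ℝ} (hβ : 0 < β) (hΛ : 0 < Λ) {B₁ B₂ : ℝ} (hB₁ : ∀ x, |deriv salmhoferCutoff x| ≤ B₁)
    (hB₂ : ∀ x, |deriv (deriv salmhoferCutoff) x| ≤ B₂) {M v : ℝ} (hM : 0 < M) (hMv : M ≤ 2 * |v|) (e : ℝ) :
    |ppTrueNumeratorDuu β Λ e v| ≤ (64 * B₂ + 96 * B₁ + 132) / M ^ 2 := by
  have hB0 := salmhoferB₁_nonneg hB₁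
  have hB20 : 0 ≤ B₂ := (abs_nonneg _).trans (hB₂ 0)
  rcases le_or_gt |v| Λ with hnear | hfar
  · have h := abs_ppTrueNumeratorDuu_le_unif hβ hΛ hB₁ hB₂ e v
    have hMΛ : M ≤ 2 * Λ := hMv.trans (by linarith)
    have hM2 : M ^ 2 ≤ 4 * Λ ^ 2 := by nlinarith
    calc |ppTrueNumeratorDuu β Λ e v| ≤ (16 * B₂ + 24 * B₁ + 30) / Λ ^ 2 := h
      _ ≤ (64 * B₂ + 96 * B₁ + 120) / M ^ 2 := by rw [div_le_div_iff₀ (by positivity) (by positivity)]; nlinarith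
      _ ≤ (64 * B₂ + 96 * B₁ + 132) / M ^ 2 := div_le_div_of_nonneg_right (by linarith) (by positivity)
  · have h := abs_ppTrueNumeratorDuu_far_le hβ hΛ hfar e
    have hv0 : 0 < |v| := hΛ.trans hfar
    have hvne : v ≠ 0 := abs_pos.1 hv0
    have hv2 : M ^ 2 ≤ 4 * v ^ 2 := by rw [← sq_abs v]; nlinarith
    calc |ppTrueNumeratorDuu β Λ e v| ≤ 3 / v ^ 2 := h
      _ ≤ 12 / M ^ 2 := by rw [div_le_div_iff₀ (by positivity) (by positivity)]; nlinarith
      _ ≤ (64 * B₂ + 96 * B₁ + 132) / M ^ 2 := div_le_div_of_nonneg_right (by nlinarith) (by positivity)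

/-- **Near the anti-diagonal the segment is far from the Fermi level**: `0 < e`, `|e+u| ≤ max(e,|u|)/2` ⟹ every `v ∈ [[−e, u]]` has `max(e,|u|) ≤ 2|v|`. [folklore] -/
theorem segment_scale_of_near_antidiag {e u : ℝ} (he : 0 < e) (hsmall : |e + u| ≤ max e |u| / 2) : ∀ v ∈ uIcc (-e) u, max e |u| ≤ 2 * |v| := by
  intro v hv
  set M : ℝ := max e |u| with hM
  have h1 : e + u ≤ M / 2 := (le_abs_self _).trans hsmall
  have h2 : -(M / 2) ≤ e + u := by linarith [neg_abs_le (e + u)]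
  have hends : u ≤ -(M / 2) ∧ -e ≤ -(M / 2) := by
    rcases le_total e |u| with h | h
    · have hMu' : M = |u| := by rw [hM, max_eq_right h]
      have hun : u < 0 := by
        by_contra hnn
        rw [abs_of_nonneg (not_lt.1 hnn)] at hMu'
        linarith
      rw [abs_of_neg hun] at hMu'
      constructor <;> linarith
    · have hMe' : M = e := by rw [hM, max_eq_left h]
      constructor <;> linarith
  have hvle : v ≤ -(M / 2) := by
    rcases mem_uIcc.1 hv with ⟨_, h3⟩ | ⟨_, h3⟩
    · exact h3.trans hends.1
    · exact h3.trans hends.2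
  have hM0 : 0 < M := he.trans_le (le_max_left _ _)
  rw [abs_of_neg (by linarith)]
  linarith

/-! ## §2 Near the anti-diagonal: no split needed -/

/-- **THE SIGNED DERIVATIVE ENVELOPE NEAR `u = −e`.**  `0 < β`, `0 < Λ`, `|χ′| ≤ B₁`, `|χ″| ≤ B₂`, `0 < e`, `e + u ≠ 0`, `|e+u| ≤ max(e,|u|)/2`:
`|∂ᵤN(e,u)/(e+u) − N(e,u)/(e+u)²| ≤ (64B₂+96B₁+132)·(max e |u|)⁻¹²`. [cite: BenfattoGiulianiMastropietro2006, §2.4 (2.36)] -/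
theorem abs_trueKernelDu_signed_near_le {β Λ : ℝ} (hβ : 0 < β) (hΛ : 0 < Λ) {B₁ B₂ : ℝ} (hB₁ : ∀ x, |deriv salmhoferCutoff x| ≤ B₁)
    (hB₂ : ∀ x, |deriv (deriv salmhoferCutoff) x| ≤ B₂) {e u : ℝ} (he : 0 < e) (hs : e + u ≠ 0) (hsmall : |e + u| ≤ max e |u| / 2) :
    |ppTrueNumeratorDu β Λ e u / (e + u) - ppTrueNumerator β Λ e u / (e + u) ^ 2| ≤ (64 * B₂ + 96 * B₁ + 132) * (max e |u|)⁻¹ ^ 2 := by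
  have hB0 := salmhoferB₁_nonneg hB₁
  have hB20 : 0 ≤ B₂ := (abs_nonneg _).trans (hB₂ 0)
  set M : ℝ := max e |u| with hM
  have hM0 : 0 < M := he.trans_le (le_max_left _ _)
  have hseg := segment_scale_of_near_antidiag he hsmall
  set C : ℝ := (64 * B₂ + 96 * B₁ + 132) / M ^ 2 with hC
  have hC0 : 0 ≤ C := by positivity
  -- `ψ(v) = ∂ᵤN(e,v)(e+v) − N(e,v)`, `ψ(−e) = 0`, `ψ′(v) = ∂ᵤ²N(e,v)(e+v)`
  set ψ : ℝ → ℝ := fun v => ppTrueNumeratorDu β Λ e v * (e + v) - ppTrueNumerator β Λ e v with hψ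
  have hψ0 : ψ (-e) = 0 := by simp only [hψ]; rw [ppTrueNumerator_antidiag]; ring
  have hψd : ∀ v, HasDerivAt ψ (ppTrueNumeratorDuu β Λ e v * (e + v)) v := fun v => by
    have h1 := hasDerivAt_ppTrueNumeratorDu_u hβ hΛ hB₁ hB₂ e v
    have h2 : HasDerivAt (fun w : ℝ => e + w) 1 v := (hasDerivAt_id v).const_add e
    have h3 := hasDerivAt_ppTrueNumerator_u hβ hΛ hB₁ e v
    have h := (h1.fun_mul h2).fun_sub h3
    refine (h.congr_of_eventuallyEq (Eventually.of_forall fun w => by simp only [hψ])).congr_deriv ?_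
    ring
  -- on the segment `|ψ′(v)| ≤ C·|e+u|`
  have hbd : ∀ v ∈ uIcc (-e) u, ‖ppTrueNumeratorDuu β Λ e v * (e + v)‖ ≤ C * |e + u| := fun v hv => by
    rw [Real.norm_eq_abs, abs_mul]
    have h1 := abs_ppTrueNumeratorDuu_le_of_scale hβ hΛ hB₁ hB₂ hM0 (hseg v hv) e
    have h2 : |e + v| ≤ |e + u| := by
      have := Set.abs_sub_left_of_mem_uIcc hv   -- `|u − (−e)|` dominates `|v − (−e)|`
      rw [show v - -e = e + v by ring, show u - -e = e + u by ring] at this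
      exact this
    exact mul_le_mul h1 h2 (abs_nonneg _) hC0
  have hMVT := Convex.norm_image_sub_le_of_norm_hasDerivWithin_le (f := ψ) (fun v _ => (hψd v).hasDerivWithinAt) hbd (convex_uIcc _ _)
    left_mem_uIcc right_mem_uIcc
  rw [hψ0, sub_zero, Real.norm_eq_abs, Real.norm_eq_abs, show u - -e = e + u by ring] at hMVT
  -- `K′ = ψ(u)/(e+u)²`
  have hK : ppTrueNumeratorDu β Λ e u / (e + u) - ppTrueNumerator β Λ e u / (e + u) ^ 2 = ψ u / (e + u) ^ 2 := by
    simp only [hψ]; field_simp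
  have hs2 : 0 < (e + u) ^ 2 := by positivity
  rw [hK, abs_div, abs_of_pos hs2, div_le_iff₀ hs2]
  calc |ψ u| ≤ C * |e + u| * |e + u| := hMVT
    _ = C * (e + u) ^ 2 := by rw [mul_assoc, ← sq, sq_abs]
    _ = (64 * B₂ + 96 * B₁ + 132) * M⁻¹ ^ 2 * (e + u) ^ 2 := by rw [hC, inv_pow, div_eq_mul_inv]

/-! ## §3 Away from the anti-diagonal: on the split's support -/

/-- **Support-conditioned gradient**: `0 < c ≤ 1`, `c·e ≤ |u|`, `0 < e` ⟹ `|∂ᵤN(e,u)| ≤ (6B₁+9/2)/(c·max(e,|u|))`.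
[cite: BenfattoGiulianiMastropietro2006, §2.4 (2.36)] -/
theorem abs_ppTrueNumeratorDu_le_of_support {β Λ : ℝ} (hβ : 0 < β) (hΛ : 0 < Λ) {B₁ : ℝ} (hB₁ : ∀ x, |deriv salmhoferCutoff x| ≤ B₁) {c e u : ℝ}
    (hc : 0 < c) (hc1 : c ≤ 1) (he : 0 < e) (hsupp : c * e ≤ |u|) : |ppTrueNumeratorDu β Λ e u| ≤ (6 * B₁ + 9 / 2) / (c * max e |u|) := by
  have hB0 := salmhoferB₁_nonneg hB₁
  set M : ℝ := max e |u| with hM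
  have hM0 : 0 < M := he.trans_le (le_max_left _ _)
  have huM : c * M ≤ |u| := by
    rcases le_total e |u| with h | h
    · rw [hM, max_eq_right h]; nlinarith [abs_nonneg u]
    · rw [hM, max_eq_left h]; exact hsupp
  have hu0 : 0 < |u| := (by positivity : 0 < c * M).trans_le huM
  rcases le_or_gt |u| Λ with hnear | hfar
  · have h := abs_ppTrueNumeratorDu_le_unif hβ hΛ hB₁ e u
    calc |ppTrueNumeratorDu β Λ e u| ≤ (6 * B₁ + 5 / 2) / Λ := h
      _ ≤ (6 * B₁ + 5 / 2) / (c * M) := div_le_div_of_nonneg_left (by positivity) (by positivity) (huM.trans hnear)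
      _ ≤ (6 * B₁ + 9 / 2) / (c * M) := div_le_div_of_nonneg_right (by linarith) (by positivity)
  · have h := abs_ppTrueNumeratorDu_le_two_div_abs hβ hΛ hfar e
    calc |ppTrueNumeratorDu β Λ e u| ≤ 2 / |u| := h
      _ ≤ 2 / (c * M) := div_le_div_of_nonneg_left (by norm_num) (by positivity) huM
      _ ≤ (6 * B₁ + 9 / 2) / (c * M) := div_le_div_of_nonneg_right (by linarith) (by positivity)

/-- **THE SIGNED DERIVATIVE ENVELOPE AWAY FROM `u = −e`** (`max(e,|u|)/2 ≤ |e+u|`, support `c·e ≤ |u|`, `0 < c ≤ 1`):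
`|∂ᵤN/(e+u) − N/(e+u)²| ≤ ((12B₁+9)/c + 4)·(max e |u|)⁻¹²`. [cite: BenfattoGiulianiMastropietro2006, §2.4 (2.36)] -/
theorem abs_trueKernelDu_signed_far_le {β Λ : ℝ} (hβ : 0 < β) (hΛ : 0 < Λ) {B₁ : ℝ} (hB₁ : ∀ x, |deriv salmhoferCutoff x| ≤ B₁) {c e u : ℝ}
    (hc : 0 < c) (hc1 : c ≤ 1) (he : 0 < e) (hsupp : c * e ≤ |u|) (hbig : max e |u| / 2 ≤ |e + u|) :
    |ppTrueNumeratorDu β Λ e u / (e + u) - ppTrueNumerator β Λ e u / (e + u) ^ 2| ≤ ((12 * B₁ + 9) / c + 4) * (max e |u|)⁻¹ ^ 2 := by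
  have hB0 := salmhoferB₁_nonneg hB₁
  set M : ℝ := max e |u| with hM
  have hM0 : 0 < M := he.trans_le (le_max_left _ _)
  have hs0 : 0 < |e + u| := (by positivity : 0 < M / 2).trans_le hbig
  have hinv : 1 / |e + u| ≤ 2 / M := by rw [div_le_div_iff₀ hs0 hM0]; linarith
  have hDu := abs_ppTrueNumeratorDu_le_of_support hβ hΛ hB₁ hc hc1 he hsupp
  have hN := abs_ppTrueNumerator_le_one hβ Λ e u
  have hA : |ppTrueNumeratorDu β Λ e u / (e + u)| ≤ (6 * B₁ + 9 / 2) / (c * M) * (2 / M) := by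
    rw [abs_div, div_eq_mul_one_div]
    exact mul_le_mul hDu hinv (by positivity) (by positivity)
  have hB : |ppTrueNumerator β Λ e u / (e + u) ^ 2| ≤ 1 * (2 / M) ^ 2 := by
    rw [abs_div, abs_pow, div_eq_mul_one_div, ← one_div_pow]
    exact mul_le_mul hN (pow_le_pow_left₀ (by positivity) hinv 2) (by positivity) zero_le_one
  refine (abs_sub _ _).trans ((add_le_add hA hB).trans (le_of_eq ?_))
  rw [inv_pow]
  field_simp
  ring

/-! ## §4 Both regimes -/

/-- **`hK1` FOR THE SIGNED TRUE KERNEL ON THE SPLIT'S SUPPORT.**  `0 < β`, `0 < Λ`, `|χ′| ≤ B₁`, `|χ″| ≤ B₂`, `0 < c ≤ 1`; `0 < e`, `e + u ≠ 0`, `c·e ≤ |u|`: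
`|∂ᵤ[N(e,u)/(e+u)]| ≤ (64B₂ + 96B₁ + 136 + (12B₁+9)/c)·(max e |u|)⁻¹²`. [cite: BenfattoGiulianiMastropietro2006, §2.4 (2.36)] -/
theorem abs_trueKernelDu_signed_le_inv_max_sq {β Λ : ℝ} (hβ : 0 < β) (hΛ : 0 < Λ) {B₁ B₂ : ℝ} (hB₁ : ∀ x, |deriv salmhoferCutoff x| ≤ B₁)
    (hB₂ : ∀ x, |deriv (deriv salmhoferCutoff) x| ≤ B₂) {c e u : ℝ} (hc : 0 < c) (hc1 : c ≤ 1) (he : 0 < e) (hs : e + u ≠ 0) (hsupp : c * e ≤ |u|) :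
    |ppTrueNumeratorDu β Λ e u / (e + u) - ppTrueNumerator β Λ e u / (e + u) ^ 2| ≤
      (64 * B₂ + 96 * B₁ + 136 + (12 * B₁ + 9) / c) * (max e |u|)⁻¹ ^ 2 := by
  have hB0 := salmhoferB₁_nonneg hB₁
  have hB20 : 0 ≤ B₂ := (abs_nonneg _).trans (hB₂ 0)
  have hM0 : 0 < max e |u| := he.trans_le (le_max_left _ _)
  have hI : 0 ≤ (max e |u|)⁻¹ ^ 2 := by positivity
  rcases le_or_gt |e + u| (max e |u| / 2) with hsmall | hbig
  · refine (abs_trueKernelDu_signed_near_le hβ hΛ hB₁ hB₂ he hs hsmall).trans ?_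
    apply mul_le_mul_of_nonneg_right _ hI
    have : 0 ≤ (12 * B₁ + 9) / c := by positivity
    linarith
  · refine (abs_trueKernelDu_signed_far_le hβ hΛ hB₁ hc hc1 he hsupp hbig.le).trans ?_
    apply mul_le_mul_of_nonneg_right _ hI
    linarith

end Summit.HubbardSuperconductivity.HubbardSuperconductivity.Theorems.C4a

end
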